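import Literature.Probability.Percolation.BergKahnLogSupermodular
import HarnessLib

/-!
# The covariance form (AC′) of the C-free pair law in the regime `τ(x,b) ≤ τ(x,a)` (BENCH rows M2-R72 / M2-R73, PROOFS §P61 (k), §P62)

Support file (`--supports stmt-CriticalPhenomena-4575`), prover seat `prim-rate-mine-2` (lane prim-rate, constants-miner (c);
`run/shared/lean/prim/prim-rate/prim-rate-mine-2/PROOFS.md` §P62; BENCH row l.240 M2-R72 (B) in the regime of l.226 (D)).
No definitions, no named facts, no sorries.

SETTING.  `μ = prodBernoulli w` on a finite vertex type, vertices `x, a, b, u`, connection events `T = {x↔a}`, `F = {x↔b}`,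
`G = {x↔u}` (`openConn`), `τ_a = μ(T)`, `τ_{ab} = μ(T ∩ F)`, … .  The COVARIANCE FORM (AC′) of the C-free pair law
(BENCH l.240 (B), PROOFS §P61 (k)) is the cubic inequality
`Cov(1_F, ψ) = τ_a·Cov(F,G) + (τ_b − τ_a)·Cov(F,G∩T) + (τ_{au} − τ_{bu})·Cov(F,T) ≥ 0`,
`ψ = τ_a 1_G + (τ_b − τ_a) 1_{G∩T} + (τ_{au} − τ_{bu}) 1_T`; it implies (AC) of BENCH l.226 (B) with the explicit margin
`A + C ≥ μ(x↮b)²·τ_a·[μ(G∣T) − μ(G∣x↮b)]`, hence `c_{ab} ≤ 0`.  (AC′) is FALSE for general positively associated events and is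
not a consequence of Harris' inequality even when `τ_b ≤ τ_a` (PROOFS §P62 (b)); here it is PROVED in the regime `τ_b ≤ τ_a`
from Harris' inequality (three instances) and van den Berg–Kahn's Theorem 1.1 (two instances: given `x ↮ b` the events
`x ↔ a`, `x ↔ u` are positively correlated; given `x ↮ a` the events `x ↔ b`, `x ↔ u` are), via two polynomial identities
(PROOFS §P62 (a)):
* (I)  `μ(R_{ab})·V = μ(R_{ab})·τ_b·Cov(F,G) + Cov(T,F)·W_b + (μ(Q_aR_b) − τ_b μ(R_b))·W_a`,
* (II) `μ(R_b)·V = (μ(Q_aR_b)μ(R_a) + τ_aτ_bμ(R_b))·Cov(F,G) + μ(R_b)(τ_bμ(R_b) − μ(Q_aR_b))·Cov(T,G) + (τ_a − τ_b)·W_b`,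
where `V` is the (AC′) functional, `Q_v = {x↔v}`, `R_v = {x↮v}`, and `W_b = μ(Q_{au}R_b)μ(R_b) − μ(Q_aR_b)μ(Q_uR_b) ≥ 0`,
`W_a = μ(Q_{bu}R_a)μ(R_a) − μ(Q_bR_a)μ(Q_uR_a) ≥ 0` are the two van den Berg–Kahn slacks; (I) is used when
`μ(Q_aR_b) ≥ τ_bμ(R_b)`, (II) otherwise.

* `CSH.pabc_real_inter_compl`, `CSH.pabc_vdBK_b`, `CSH.pabc_vdBK_a`: bookkeeping (`μ(A ∩ Bᶜ) = μ(A) − μ(A∩B)`) and the two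
  van den Berg–Kahn instances in `τ`-coordinates;
* **`CSH.pab_ACprime_nonneg_of_le`**: `τ_b ≤ τ_a ⟹ (AC′)`;
* **`CSH.pab_AC_margin_of_le`**: the consequence `A + C ≥ μ(R_b)·[τ_{au}μ(R_b) − τ_a μ(Q_uR_b)] (≥ 0)` — (AC) of BENCH l.226
  with an explicit non-negative margin, in the same regime (sharpens `CSH.pab_AC_nonneg_of_le`).
[cite: Harris1960, Lemma 4.1 (p. 16)] [cite: VandenbergKahn2001, Thm 1.1 (p. 123)]
-/

noncomputable section

namespace Summit.CriticalPhenomena.PercolationContinuityZ3.Theorems.CSH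

open MeasureTheory Set unitInterval
open Literature.Probability.LatticeModels (prodBernoulli prodBernoulli_harris)
open Literature.Probability.Percolation
open scoped Classical

variable {V : Type} [Fintype V] [DecidableEq V]

section Bookkeeping

variable (μ : Measure (BondConfig V)) [IsProbabilityMeasure μ]

omit [DecidableEq V] in
/-- `μ(A ∩ Bᶜ) = μ(A) − μ(A ∩ B)`. [folklore] -/
theorem pabc_real_inter_compl (A B : Set (BondConfig V)) :
    μ.real (A ∩ Bᶜ) = μ.real A - μ.real (A ∩ B) := by
  have h := measureReal_inter_add_sdiff (μ := μ) (s := A) (t := B) MeasurableSet.of_discrete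
  rw [Set.sdiff_eq_compl_inter, Set.inter_comm Bᶜ A] at h
  linarith

omit [DecidableEq V] in
/-- `μ(Bᶜ) = 1 − μ(B)`. [folklore] -/
theorem pabc_real_compl (B : Set (BondConfig V)) : μ.real Bᶜ = 1 - μ.real B :=
  probReal_compl_eq_one_sub MeasurableSet.of_discrete

end Bookkeeping

section VdBK

variable (w : Sym2 V → unitInterval) (x a b u : V)

/-- **van den Berg–Kahn (2001) Thm 1.1, instance `t = b`, in `τ`-coordinates**: given `x ↮ b` the events `x ↔ a`, `x ↔ u`
are positively correlated, `μ(Q_aR_b)·μ(Q_uR_b) ≤ μ(Q_{au}R_b)·μ(R_b)`, i.e.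
`(τ_a − τ_{ab})(τ_u − τ_{bu}) ≤ (τ_{au} − τ_{abu})(1 − τ_b)`. [cite: VandenbergKahn2001, Thm 1.1 (p. 123)] -/
theorem pabc_vdBK_b :
    ((prodBernoulli w).real (openConn x a) - (prodBernoulli w).real (openConn x a ∩ openConn x b)) *
        ((prodBernoulli w).real (openConn x u) - (prodBernoulli w).real (openConn x b ∩ openConn x u)) ≤
      ((prodBernoulli w).real (openConn x a ∩ openConn x u) - (prodBernoulli w).real (openConn x a ∩ openConn x b ∩ openConn x u)) *
        (1 - (prodBernoulli w).real (openConn x b)) := by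
  have h := BergKahn.bergKahn_thm_1_1 w x a u b
  set μ := prodBernoulli w with hμ
  rw [pabc_real_inter_compl μ, pabc_real_inter_compl μ, pabc_real_inter_compl μ, pabc_real_compl μ] at h
  have e1 : (openConn x u ∩ openConn x b : Set (BondConfig V)) = openConn x b ∩ openConn x u := Set.inter_comm _ _
  have e2 : (openConn x a ∩ openConn x u ∩ openConn x b : Set (BondConfig V)) = openConn x a ∩ openConn x b ∩ openConn x u := by
    ext ω; simp only [Set.mem_inter_iff]; tauto
  rw [e1, e2] at h
  exact h

/-- **van den Berg–Kahn (2001) Thm 1.1, instance `t = a`, in `τ`-coordinates**: given `x ↮ a` the events `x ↔ b`, `x ↔ u`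
are positively correlated, `(τ_b − τ_{ab})(τ_u − τ_{au}) ≤ (τ_{bu} − τ_{abu})(1 − τ_a)`. [cite: VandenbergKahn2001, Thm 1.1 (p. 123)] -/
theorem pabc_vdBK_a :
    ((prodBernoulli w).real (openConn x b) - (prodBernoulli w).real (openConn x a ∩ openConn x b)) *
        ((prodBernoulli w).real (openConn x u) - (prodBernoulli w).real (openConn x a ∩ openConn x u)) ≤
      ((prodBernoulli w).real (openConn x b ∩ openConn x u) - (prodBernoulli w).real (openConn x a ∩ openConn x b ∩ openConn x u)) *
        (1 - (prodBernoulli w).real (openConn x a)) := by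
  have h := BergKahn.bergKahn_thm_1_1 w x b u a
  set μ := prodBernoulli w with hμ
  rw [pabc_real_inter_compl μ, pabc_real_inter_compl μ, pabc_real_inter_compl μ, pabc_real_compl μ] at h
  have e1 : (openConn x b ∩ openConn x a : Set (BondConfig V)) = openConn x a ∩ openConn x b := Set.inter_comm _ _
  have e2 : (openConn x u ∩ openConn x a : Set (BondConfig V)) = openConn x a ∩ openConn x u := Set.inter_comm _ _
  have e3 : (openConn x b ∩ openConn x u ∩ openConn x a : Set (BondConfig V)) = openConn x a ∩ openConn x b ∩ openConn x u := by
    ext ω; simp only [Set.mem_inter_iff]; tauto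
  rw [e1, e2, e3] at h
  exact h

end VdBK

section Regime

variable (w : Sym2 V → unitInterval) (x a b u : V)

set_option maxHeartbeats 400000 in
/-- **(AC′) in the regime `τ_b ≤ τ_a`** (PROOFS §P62 (a); BENCH l.240 (B) restricted to the regime of l.226 (D)).
If `μ(x↔b) ≤ μ(x↔a)` then
`τ_a(τ_{bu} − τ_bτ_u) + (τ_b − τ_a)(τ_{abu} − τ_bτ_{au}) + (τ_{au} − τ_{bu})(τ_{ab} − τ_aτ_b) ≥ 0`,
i.e. `Cov(1_{x↔b}, τ_a 1_{x↔u} + (τ_b − τ_a) 1_{x↔u, x↔a} + (τ_{au} − τ_{bu}) 1_{x↔a}) ≥ 0`.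
Proof: Harris (for `(F,G)`, `(T,G)`, `(T,F)`), van den Berg–Kahn Thm 1.1 twice (`pabc_vdBK_b`, `pabc_vdBK_a`), and the
polynomial identities (I)/(II) of the file header with the case split on the sign of `μ(Q_aR_b) − τ_bμ(R_b)`.
[cite: Harris1960, Lemma 4.1 (p. 16)] [cite: VandenbergKahn2001, Thm 1.1 (p. 123)] -/
theorem pab_ACprime_nonneg_of_le
    (hle : (prodBernoulli w).real (openConn x b) ≤ (prodBernoulli w).real (openConn x a)) :
    0 ≤ (prodBernoulli w).real (openConn x a) *
          ((prodBernoulli w).real (openConn x b ∩ openConn x u) - (prodBernoulli w).real (openConn x b) * (prodBernoulli w).real (openConn x u))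
      + ((prodBernoulli w).real (openConn x b) - (prodBernoulli w).real (openConn x a)) *
          ((prodBernoulli w).real (openConn x a ∩ openConn x b ∩ openConn x u) - (prodBernoulli w).real (openConn x b) * (prodBernoulli w).real (openConn x a ∩ openConn x u))
      + ((prodBernoulli w).real (openConn x a ∩ openConn x u) - (prodBernoulli w).real (openConn x b ∩ openConn x u)) *
          ((prodBernoulli w).real (openConn x a ∩ openConn x b) - (prodBernoulli w).real (openConn x a) * (prodBernoulli w).real (openConn x b)) := by
  have hWb := pabc_vdBK_b w x a b u
  have hWa := pabc_vdBK_a w x a b u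
  set μ := prodBernoulli w with hμ
  set ta := μ.real (openConn x a)
  set tb := μ.real (openConn x b)
  set tu := μ.real (openConn x u)
  set tab := μ.real (openConn x a ∩ openConn x b)
  set tau := μ.real (openConn x a ∩ openConn x u)
  set tbu := μ.real (openConn x b ∩ openConn x u)
  set tabu := μ.real (openConn x a ∩ openConn x b ∩ openConn x u)
  -- Harris: Cov(T,G) ≥ 0, Cov(F,G) ≥ 0, Cov(T,F) ≥ 0
  have hTG : ta * tu ≤ tau := prodBernoulli_harris w (isUpperSet_openConn x a) (isUpperSet_openConn x u)
    MeasurableSet.of_discrete MeasurableSet.of_discrete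
  have hFG : tb * tu ≤ tbu := prodBernoulli_harris w (isUpperSet_openConn x b) (isUpperSet_openConn x u)
    MeasurableSet.of_discrete MeasurableSet.of_discrete
  have hTF : ta * tb ≤ tab := prodBernoulli_harris w (isUpperSet_openConn x a) (isUpperSet_openConn x b)
    MeasurableSet.of_discrete MeasurableSet.of_discrete
  -- elementary bounds
  have hta0 : 0 ≤ ta := measureReal_nonneg
  have htb0 : 0 ≤ tb := measureReal_nonneg
  have htu0 : 0 ≤ tu := measureReal_nonneg
  have hta1 : ta ≤ 1 := measureReal_le_one
  have htb1 : tb ≤ 1 := measureReal_le_one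
  have htu1 : tu ≤ 1 := measureReal_le_one
  have htab_le : tab ≤ ta := measureReal_mono Set.inter_subset_left
  have htab_le' : tab ≤ tb := measureReal_mono Set.inter_subset_right
  have htau_le : tau ≤ ta := measureReal_mono Set.inter_subset_left
  have htau_le' : tau ≤ tu := measureReal_mono Set.inter_subset_right
  have htbu_le' : tbu ≤ tu := measureReal_mono Set.inter_subset_right
  have htabu_le : tabu ≤ tbu := measureReal_mono (show (openConn x a ∩ openConn x b ∩ openConn x u : Set (BondConfig V))
      ⊆ openConn x b ∩ openConn x u from fun ω ⟨⟨_, h2⟩, h3⟩ => ⟨h2, h3⟩)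
  -- union bounds: μ(A ∩ B) ≥ μ(A) + μ(B) − 1
  have hU : ∀ (A B : Set (BondConfig V)), μ.real A + μ.real B - 1 ≤ μ.real (A ∩ B) := by
    intro A B
    have h1 := measureReal_union_add_inter (μ := μ) (s := A) (t := B) MeasurableSet.of_discrete
    have h2 : μ.real (A ∪ B) ≤ 1 := measureReal_le_one
    linarith
  have hp4 : 0 ≤ 1 - ta - tb + tab := by have := hU (openConn x a) (openConn x b); linarith
  have htau_lb : ta + tu - 1 ≤ tau := hU (openConn x a) (openConn x u)
  have htabu_lb : ta + tbu - 1 ≤ tabu := by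
    have := hU (openConn x a) (openConn x b ∩ openConn x u)
    rwa [← Set.inter_assoc] at this
  -- the two van den Berg–Kahn slacks
  have hW2 : 0 ≤ (tau - tabu) * (1 - tb) - (ta - tab) * (tu - tbu) := by linarith
  have hW3 : 0 ≤ (tbu - tabu) * (1 - ta) - (tb - tab) * (tu - tau) := by linarith
  -- identities (I) and (II)
  have hI : (1 - ta - tb + tab) * (ta * (tbu - tb * tu) + (tb - ta) * (tabu - tb * tau) + (tau - tbu) * (tab - ta * tb))
      = (1 - ta - tb + tab) * tb * (tbu - tb * tu) + (tab - ta * tb) * ((tau - tabu) * (1 - tb) - (ta - tab) * (tu - tbu))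
        + ((ta - tab) - tb * (1 - tb)) * ((tbu - tabu) * (1 - ta) - (tb - tab) * (tu - tau)) := by ring
  have hII : (1 - tb) * (ta * (tbu - tb * tu) + (tb - ta) * (tabu - tb * tau) + (tau - tbu) * (tab - ta * tb))
      = ((ta - tab) * (1 - ta) + ta * tb * (1 - tb)) * (tbu - tb * tu) + (1 - tb) * (tb * (1 - tb) - (ta - tab)) * (tau - ta * tu)
        + (ta - tb) * ((tau - tabu) * (1 - tb) - (ta - tab) * (tu - tbu)) := by ring
  by_cases hreg : tb * (1 - tb) ≤ ta - tab
  · -- region (I): every term of (I) is non-negative, so μ(R_ab)·V ≥ 0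
    have hprod : 0 ≤ (1 - ta - tb + tab) * (ta * (tbu - tb * tu) + (tb - ta) * (tabu - tb * tau) + (tau - tbu) * (tab - ta * tb)) := by
      rw [hI]
      have h1 : 0 ≤ (1 - ta - tb + tab) * tb * (tbu - tb * tu) := mul_nonneg (mul_nonneg hp4 htb0) (by linarith)
      have h2 : 0 ≤ (tab - ta * tb) * ((tau - tabu) * (1 - tb) - (ta - tab) * (tu - tbu)) := mul_nonneg (by linarith) hW2
      have h3 : 0 ≤ ((ta - tab) - tb * (1 - tb)) * ((tbu - tabu) * (1 - ta) - (tb - tab) * (tu - tau)) := mul_nonneg (by linarith) hW3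
      linarith
    by_cases hp4z : 1 - ta - tb + tab = 0
    · -- degenerate case μ(R_ab) = 0: then τ_a = 1 (Harris for T,F and τ_b ≤ τ_a), τ_{au} = τ_u, τ_{abu} = τ_{bu}, τ_{ab} = τ_b,
      -- and V = τ_b·Cov(F,G) ≥ 0
      have hta_one : ta = 1 := by
        by_contra hne
        have hlt : ta < 1 := lt_of_le_of_ne hta1 hne
        -- (1 - ta)(1 - tb) ≤ 0 from tab = ta + tb - 1 and tab ≥ ta tb
        have h1 : (1 - ta) * (1 - tb) ≤ 0 := by nlinarith
        have h2 : 0 < (1 - ta) * (1 - tb) := mul_pos (by linarith) (by linarith)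
        linarith
      have htab_eq : tab = tb := by linarith
      have htau_eq : tau = tu := le_antisymm htau_le' (by linarith)
      have htabu_eq : tabu = tbu := le_antisymm htabu_le (by linarith)
      rw [hta_one, htab_eq, htau_eq, htabu_eq]
      nlinarith [mul_nonneg htb0 (show 0 ≤ tbu - tb * tu by linarith)]
    · have hp4_pos : 0 < 1 - ta - tb + tab := lt_of_le_of_ne hp4 (Ne.symm hp4z)
      exact (mul_nonneg_iff_of_pos_left hp4_pos).1 hprod
  · -- region (II): every term of (II) is non-negative (the last one by the regime τ_b ≤ τ_a), so μ(R_b)·V ≥ 0, and μ(R_b) > 0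
    rw [not_le] at hreg
    have hprod : 0 ≤ (1 - tb) * (ta * (tbu - tb * tu) + (tb - ta) * (tabu - tb * tau) + (tau - tbu) * (tab - ta * tb)) := by
      rw [hII]
      have h1 : 0 ≤ ((ta - tab) * (1 - ta) + ta * tb * (1 - tb)) * (tbu - tb * tu) :=
        mul_nonneg (by nlinarith [mul_nonneg (sub_nonneg.2 htab_le) (sub_nonneg.2 hta1), mul_nonneg (mul_nonneg hta0 htb0) (sub_nonneg.2 htb1)]) (by linarith)
      have h2 : 0 ≤ (1 - tb) * (tb * (1 - tb) - (ta - tab)) * (tau - ta * tu) :=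
        mul_nonneg (mul_nonneg (by linarith) (by linarith)) (by linarith)
      have h3 : 0 ≤ (ta - tb) * ((tau - tabu) * (1 - tb) - (ta - tab) * (tu - tbu)) := mul_nonneg (by linarith) hW2
      linarith
    have hq_pos : 0 < 1 - tb := by
      by_contra hq
      rw [not_lt] at hq
      have htb_one : tb = 1 := le_antisymm htb1 (by linarith)
      rw [htb_one] at hreg
      have : 0 ≤ ta - tab := by linarith
      linarith
    exact (mul_nonneg_iff_of_pos_left hq_pos).1 hprod

/-- **(AC) with an explicit margin in the regime `τ_b ≤ τ_a`** (PROOFS §P61 (k), §P62 (a)): since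
`A + C − μ(R_b)·E[h] = V` (the (AC′) functional) with `E[h] = τ_{au}μ(R_b) − τ_aμ(Q_uR_b) = τ_{au}(1 − τ_b) − τ_a(τ_u − τ_{bu}) ≥ 0`
(Harris), the regime theorem gives
`AC ≥ (1 − τ_b)·[τ_{au}(1 − τ_b) − τ_a(τ_u − τ_{bu})] ≥ 0`, where
`AC = τ_{au} − τ_aτ_u + τ_{au}(τ_{ab} − 2τ_b) + τ_{bu}(2τ_a − τ_{ab}) + τ_{abu}(τ_b − τ_a)` is the functional of
`CSH.pab_AC_nonneg_of_le` (BENCH l.226 (B)); this sharpens that theorem by the explicit non-negative margin.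
[cite: Harris1960, Lemma 4.1 (p. 16)] [cite: VandenbergKahn2001, Thm 1.1 (p. 123)] -/
theorem pab_AC_margin_of_le
    (hle : (prodBernoulli w).real (openConn x b) ≤ (prodBernoulli w).real (openConn x a)) :
    (1 - (prodBernoulli w).real (openConn x b)) *
        ((prodBernoulli w).real (openConn x a ∩ openConn x u) * (1 - (prodBernoulli w).real (openConn x b))
          - (prodBernoulli w).real (openConn x a) * ((prodBernoulli w).real (openConn x u) - (prodBernoulli w).real (openConn x b ∩ openConn x u)))
      ≤ (prodBernoulli w).real (openConn x a ∩ openConn x u) - (prodBernoulli w).real (openConn x a) * (prodBernoulli w).real (openConn x u)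
        + (prodBernoulli w).real (openConn x a ∩ openConn x u) * ((prodBernoulli w).real (openConn x a ∩ openConn x b) - 2 * (prodBernoulli w).real (openConn x b))
        + (prodBernoulli w).real (openConn x b ∩ openConn x u) * (2 * (prodBernoulli w).real (openConn x a) - (prodBernoulli w).real (openConn x a ∩ openConn x b))
        + (prodBernoulli w).real (openConn x a ∩ openConn x b ∩ openConn x u) * ((prodBernoulli w).real (openConn x b) - (prodBernoulli w).real (openConn x a)) := by
  have hV := pab_ACprime_nonneg_of_le w x a b u hle
  set μ := prodBernoulli w with hμ
  set ta := μ.real (openConn x a)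
  set tb := μ.real (openConn x b)
  set tu := μ.real (openConn x u)
  set tab := μ.real (openConn x a ∩ openConn x b)
  set tau := μ.real (openConn x a ∩ openConn x u)
  set tbu := μ.real (openConn x b ∩ openConn x u)
  set tabu := μ.real (openConn x a ∩ openConn x b ∩ openConn x u)
  have hid : tau - ta * tu + tau * (tab - 2 * tb) + tbu * (2 * ta - tab) + tabu * (tb - ta)
      - (1 - tb) * (tau * (1 - tb) - ta * (tu - tbu))
      = ta * (tbu - tb * tu) + (tb - ta) * (tabu - tb * tau) + (tau - tbu) * (tab - ta * tb) := by ring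
  linarith [hid, hV]

end Regime

section AlphaBeta

variable (w : Sym2 V → unitInterval) (x a b u : V)

/-- **The `a ∉ 𝒞_x` half of (AC′) holds for ALL weights** (PROOFS §P62 (e); appended 2026-08-24 by the same seat).  Split the functional
`h = h₀ + h₁` of BENCH l.240 by the cases `a ∉ 𝒞_x` / `a ∈ 𝒞_x`, `h₀ = 1_{x↮a}(τ_{au} − τ_a 1_{x↔u})`; then
`−Cov(1_{x↔b}, h₀) = τ_{au}·Cov(F,T) + τ_a·Cov(F, G ∩ Tᶜ) = τ_{au}(τ_{ab} − τ_aτ_b) + τ_a[(τ_{bu} − τ_{abu}) − τ_b(τ_u − τ_{au})] ≥ 0`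
with NO regime hypothesis: by the identity `μ(R_a)·α = τ_a·W_a + Cov(T,F)·Cov(T,G)` (`W_a` the van den Berg–Kahn slack at `t = a`)
and Harris twice; the degenerate case `μ(R_a) = 0` forces `α = 0`.
[cite: Harris1960, Lemma 4.1 (p. 16)] [cite: VandenbergKahn2001, Thm 1.1 (p. 123)] -/
theorem pab_ACprime_alpha_nonneg :
    0 ≤ (prodBernoulli w).real (openConn x a ∩ openConn x u) *
          ((prodBernoulli w).real (openConn x a ∩ openConn x b) - (prodBernoulli w).real (openConn x a) * (prodBernoulli w).real (openConn x b))
      + (prodBernoulli w).real (openConn x a) *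
          (((prodBernoulli w).real (openConn x b ∩ openConn x u) - (prodBernoulli w).real (openConn x a ∩ openConn x b ∩ openConn x u))
            - (prodBernoulli w).real (openConn x b) * ((prodBernoulli w).real (openConn x u) - (prodBernoulli w).real (openConn x a ∩ openConn x u))) := by
  have hWa := pabc_vdBK_a w x a b u
  set μ := prodBernoulli w with hμ
  set ta := μ.real (openConn x a)
  set tb := μ.real (openConn x b)
  set tu := μ.real (openConn x u)
  set tab := μ.real (openConn x a ∩ openConn x b)
  set tau := μ.real (openConn x a ∩ openConn x u)
  set tbu := μ.real (openConn x b ∩ openConn x u)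
  set tabu := μ.real (openConn x a ∩ openConn x b ∩ openConn x u)
  have hTG : ta * tu ≤ tau := prodBernoulli_harris w (isUpperSet_openConn x a) (isUpperSet_openConn x u)
    MeasurableSet.of_discrete MeasurableSet.of_discrete
  have hTF : ta * tb ≤ tab := prodBernoulli_harris w (isUpperSet_openConn x a) (isUpperSet_openConn x b)
    MeasurableSet.of_discrete MeasurableSet.of_discrete
  have hta0 : 0 ≤ ta := measureReal_nonneg
  have hta1 : ta ≤ 1 := measureReal_le_one
  have htab_le' : tab ≤ tb := measureReal_mono Set.inter_subset_right
  have htau_le' : tau ≤ tu := measureReal_mono Set.inter_subset_right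
  have htabu_le : tabu ≤ tbu := measureReal_mono (show (openConn x a ∩ openConn x b ∩ openConn x u : Set (BondConfig V))
      ⊆ openConn x b ∩ openConn x u from fun ω ⟨⟨_, h2⟩, h3⟩ => ⟨h2, h3⟩)
  have hU : ∀ (A B : Set (BondConfig V)), μ.real A + μ.real B - 1 ≤ μ.real (A ∩ B) := by
    intro A B
    have h1 := measureReal_union_add_inter (μ := μ) (s := A) (t := B) MeasurableSet.of_discrete
    have h2 : μ.real (A ∪ B) ≤ 1 := measureReal_le_one
    linarith
  have htab_lb : ta + tb - 1 ≤ tab := hU (openConn x a) (openConn x b)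
  have htau_lb : ta + tu - 1 ≤ tau := hU (openConn x a) (openConn x u)
  have htabu_lb : ta + tbu - 1 ≤ tabu := by
    have := hU (openConn x a) (openConn x b ∩ openConn x u)
    rwa [← Set.inter_assoc] at this
  have hW3 : 0 ≤ (tbu - tabu) * (1 - ta) - (tb - tab) * (tu - tau) := by linarith
  -- identity (III): μ(R_a)·α = τ_a·W_a + Cov(T,F)·Cov(T,G)
  have hIII : (1 - ta) * (tau * (tab - ta * tb) + ta * ((tbu - tabu) - tb * (tu - tau)))
      = ta * ((tbu - tabu) * (1 - ta) - (tb - tab) * (tu - tau)) + (tab - ta * tb) * (tau - ta * tu) := by ring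
  have hprod : 0 ≤ (1 - ta) * (tau * (tab - ta * tb) + ta * ((tbu - tabu) - tb * (tu - tau))) := by
    rw [hIII]
    have h1 : 0 ≤ ta * ((tbu - tabu) * (1 - ta) - (tb - tab) * (tu - tau)) := mul_nonneg hta0 hW3
    have h2 : 0 ≤ (tab - ta * tb) * (tau - ta * tu) := mul_nonneg (by linarith) (by linarith)
    linarith
  by_cases hr : 1 - ta = 0
  · -- degenerate case τ_a = 1: τ_{ab} = τ_b, τ_{au} = τ_u, τ_{abu} = τ_{bu}, and α = 0
    have hta_one : ta = 1 := by linarith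
    have e1 : tab = tb := le_antisymm htab_le' (by linarith)
    have e2 : tau = tu := le_antisymm htau_le' (by linarith)
    have e3 : tabu = tbu := le_antisymm htabu_le (by linarith)
    rw [hta_one, e1, e2, e3]; ring_nf; exact le_refl 0
  · have hr_pos : 0 < 1 - ta := lt_of_le_of_ne (by linarith) (Ne.symm hr)
    exact (mul_nonneg_iff_of_pos_left hr_pos).1 hprod

/-- **(AC′) reduced to its `a ∈ 𝒞_x` half, for ALL weights** (PROOFS §P62 (e)): since `V = α + β` with `α ≥ 0`
(`pab_ACprime_alpha_nonneg`), the (AC′) functional of BENCH l.240 is bounded below by its `h₁`-part,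
`V ≥ β := τ_b·Cov(F, G ∩ T) − τ_{bu}·Cov(F,T) = τ_b(τ_{abu} − τ_bτ_{au}) − τ_{bu}(τ_{ab} − τ_aτ_b)`; in particular (AC′) —
hence (AC) and `c_{ab} ≤ 0` — holds whenever `τ_b·Cov(1_{x↔b}, 1_{x↔a, x↔u}) ≥ τ_{bu}·Cov(1_{x↔b}, 1_{x↔a})`, with no hypothesis
on the order of `τ_a, τ_b` (a criterion available in the tower regime `τ_b > τ_a`, where `pab_ACprime_nonneg_of_le` is silent).
[cite: Harris1960, Lemma 4.1 (p. 16)] [cite: VandenbergKahn2001, Thm 1.1 (p. 123)] -/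
theorem pab_ACprime_ge_beta :
    (prodBernoulli w).real (openConn x b) *
          ((prodBernoulli w).real (openConn x a ∩ openConn x b ∩ openConn x u) - (prodBernoulli w).real (openConn x b) * (prodBernoulli w).real (openConn x a ∩ openConn x u))
      - (prodBernoulli w).real (openConn x b ∩ openConn x u) *
          ((prodBernoulli w).real (openConn x a ∩ openConn x b) - (prodBernoulli w).real (openConn x a) * (prodBernoulli w).real (openConn x b))
    ≤ (prodBernoulli w).real (openConn x a) *
          ((prodBernoulli w).real (openConn x b ∩ openConn x u) - (prodBernoulli w).real (openConn x b) * (prodBernoulli w).real (openConn x u))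
      + ((prodBernoulli w).real (openConn x b) - (prodBernoulli w).real (openConn x a)) *
          ((prodBernoulli w).real (openConn x a ∩ openConn x b ∩ openConn x u) - (prodBernoulli w).real (openConn x b) * (prodBernoulli w).real (openConn x a ∩ openConn x u))
      + ((prodBernoulli w).real (openConn x a ∩ openConn x u) - (prodBernoulli w).real (openConn x b ∩ openConn x u)) *
          ((prodBernoulli w).real (openConn x a ∩ openConn x b) - (prodBernoulli w).real (openConn x a) * (prodBernoulli w).real (openConn x b)) := by
  have hα := pab_ACprime_alpha_nonneg w x a b u
  set μ := prodBernoulli w with hμ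
  set ta := μ.real (openConn x a)
  set tb := μ.real (openConn x b)
  set tu := μ.real (openConn x u)
  set tab := μ.real (openConn x a ∩ openConn x b)
  set tau := μ.real (openConn x a ∩ openConn x u)
  set tbu := μ.real (openConn x b ∩ openConn x u)
  set tabu := μ.real (openConn x a ∩ openConn x b ∩ openConn x u)
  have hsplit : ta * (tbu - tb * tu) + (tb - ta) * (tabu - tb * tau) + (tau - tbu) * (tab - ta * tb)
      = (tau * (tab - ta * tb) + ta * ((tbu - tabu) - tb * (tu - tau))) + (tb * (tabu - tb * tau) - tbu * (tab - ta * tb)) := by ring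
  linarith [hsplit, hα]

end AlphaBeta

end Summit.CriticalPhenomena.PercolationContinuityZ3.Theorems.CSH
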